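import Literature.AlgebraicGeometry.Frobenioids.ArchimedeanBasicProperties
import Literature.AlgebraicGeometry.Frobenioids.AngularFrobenioidsRelative
import Literature.AlgebraicGeometry.Frobenioids.ArchimedeanBaseComparison
import Literature.AlgebraicGeometry.Frobenioids.ArchimedeanArcs
import Literature.AlgebraicGeometry.Frobenioids.ArchimedeanDivisorMaximality
import HarnessLib

/-!
# Frobenioids II, Theorem 3.6 (viii) — PROVED for `C = C^ℤ` and `A`: `F[ℂ]` is of weakly dissectible type

Mochizuki, *The geometry of Frobenioids II*, Kyushu J. Math. **62** (2008) 401–460, §3, Thm. 3.6 (viii),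
kurims p. 38 [cite: MochizukiFrdII2008, Thm 3.6 (viii) p.38]: "(viii) If `Λ = ℤ`, then `F[ℂ]` is of
weakly dissectible type [cf. §0]" (proof p. 39: a dissecting pair `B₁ → A`, `B₂ → A` whose angular
regions map to disjoint opens of that of `A`). DISCHARGE of `ArchFrd.Thm36viii`
(`ArchimedeanBasicProperties.lean`) at `C π` and at the angular Frobenioid `A π` of Example 3.3 over any
base `π : D → D₀` (seat abc-iut-L1-t6; `D₀` read in `ArchBase` via `D0.toArchBase`; `F[ℂ]` =
`RC.ComplexPart`, "weakly dissectible" = `IsOfWeaklyDissectibleType` of `Dissection.lean`). For a complex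
`A` take the two ARC sub-objects (same base and tip) whose angular parts are the arcs of half-width
`ε/4` around `w·e^{±iε/2}`, the arc of half-width `ε` around `w` lying in the angular part of `A`
(`ArchimedeanArcs.lean`, seat abc-iut-L1-t6): non-initial, included in `A` by `(id, 1, 1)` (an
isometry), and no object maps to both compatibly — the two composites would have equal data `(b, d, c)`
and the nonempty set `c · A_B^d` would lie in the `ι_b`-images of two disjoint regions.
No statement of the paper is strengthened.
-/

namespace Literature.AlgebraicGeometry.Frobenioids

open CategoryTheory CategoryTheory.Limits
open scoped Pointwise

universe v u

namespace ArchFrd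

/-- `e^{ia} e^{ib} = e^{i(a+b)}` in `S¹ = O_ℂ^×` (for abc-iut-L1-t6's `ArchFrd.expUnit : ℝ → O_ℂ^×`).
[cite: MochizukiFrdII2008, Def 3.1 (ii) p.23] -/
theorem arcExpUnit_mul (a b : ℝ) : expUnit a * expUnit b = expUnit (a + b) := by
  apply Subtype.ext; apply Units.ext
  change ((expUnit a : ℂˣ) : ℂ) * ((expUnit b : ℂˣ) : ℂ) = ((expUnit (a + b) : ℂˣ) : ℂ)
  rw [coe_expUnit, coe_expUnit, coe_expUnit, Complex.ofReal_add, add_mul, Complex.exp_add]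

/-- On the arc of half-width `η` around `w·e^{iδ}` (`|δ| + η ≤ π`): `relArg w = δ + relArg (w·e^{iδ})`.
[cite: MochizukiFrdII2008, Def 3.1 (iii) p.24] -/
theorem relArg_of_mem_arcDir_shift (w : normOneSubgroup ℂ) {δ η : ℝ} (hδη : |δ| + η ≤ Real.pi)
    {z : normOneSubgroup ℂ} (hz : z ∈ arcDir (w * expUnit δ) η) :
    relArg w z = δ + relArg (w * expUnit δ) z := by
  have hθ : relArg (w * expUnit δ) z ∈ Set.Ioo (-η) η := hz
  have hzeq : z = w * expUnit (δ + relArg (w * expUnit δ) z) := by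
    rw [← arcExpUnit_mul, ← mul_assoc, mul_expUnit_relArg]
  conv_lhs => rw [hzeq]
  apply relArg_mul_expUnit
  constructor
  · have := neg_abs_le δ; linarith [hθ.1]
  · have := le_abs_self δ; linarith [hθ.2]

/-- The arcs of half-width `ε/4` around `w·e^{±iε/2}` are disjoint. [cite: MochizukiFrdII2008, Thm 3.6 (viii) p.38] -/
theorem arcDir_disjoint (w : normOneSubgroup ℂ) {ε : ℝ} (hε : 0 < ε) (hεπ : ε < Real.pi)
    {z : normOneSubgroup ℂ} (h₀ : z ∈ arcDir (w * expUnit (ε / 2)) (ε / 4))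
    (h₁ : z ∈ arcDir (w * expUnit (-(ε / 2))) (ε / 4)) : False := by
  have hb : |ε / 2| + ε / 4 ≤ Real.pi := by rw [abs_of_pos (by linarith)]; linarith
  have hb' : |-(ε / 2)| + ε / 4 ≤ Real.pi := by rw [abs_neg, abs_of_pos (by linarith)]; linarith
  have e₀ := relArg_of_mem_arcDir_shift w hb h₀
  have e₁ := relArg_of_mem_arcDir_shift w hb' h₁
  have t₀ : relArg (w * expUnit (ε / 2)) z ∈ Set.Ioo (-(ε / 4)) (ε / 4) := h₀
  have t₁ : relArg (w * expUnit (-(ε / 2))) z ∈ Set.Ioo (-(ε / 4)) (ε / 4) := h₁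
  linarith [t₀.1, t₁.2]

/-- The arc of half-width `ε/4` around `w·e^{±iε/2}` lies in the `ε`-arc around `w`. [cite: MochizukiFrdII2008, Thm 3.6 (viii) p.38] -/
theorem arcDir_shift_subset (w : normOneSubgroup ℂ) {ε δ : ℝ} (hε : 0 < ε) (hεπ : ε < Real.pi)
    (hδ : |δ| = ε / 2) : arcDir (w * expUnit δ) (ε / 4) ⊆ arcDir w ε := by
  intro z hz
  have hb : |δ| + ε / 4 ≤ Real.pi := by rw [hδ]; linarith
  have e := relArg_of_mem_arcDir_shift w hb hz
  have t : relArg (w * expUnit δ) z ∈ Set.Ioo (-(ε / 4)) (ε / 4) := hz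
  change relArg w z ∈ Set.Ioo (-ε) ε
  rw [e]
  have h1 := neg_abs_le δ
  have h2 := le_abs_self δ
  constructor <;> linarith [t.1, t.2]

/-- An object of `C₀` whose base maps to `Spec ℂ` is complex. [cite: MochizukiFrdII2008, §3 p.23] -/
theorem isComplexObj_of_hom {X : C0} {L : D0} (f : X.base ⟶ L) (hL : L.IsComplex) :
    X.IsComplexObj := by
  unfold C0.IsComplexObj D0.IsComplex at *
  subst hL
  rcases X with ⟨K, R, h⟩
  cases K
  · exact (D0.isEmpty_hom_real_complex.false f).elim
  · rfl

variable {D : Type u} [Category.{v} D] (π : D ⥤ D0)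

namespace WeakDissection

variable {π}

/-- The arc sub-object of a complex `A ∈ Ob(C)`: same base data and tip, angular part the `η`-arc around
`w'`. [cite: MochizukiFrdII2008, Thm 3.6 (viii) p.38] -/
noncomputable def arcObj (A : C π) (hc : A.fst.IsComplexObj) (w' : normOneSubgroup ℂ) (η : ℝ)
    (hη : 0 < η) (hηπ : η < Real.pi) : C π :=
  ⟨⟨A.fst.base, arcRegion w' η hη hηπ A.fst.region.tip, fun h => by
      have h' : A.fst.base = D0.real := h
      rw [show A.fst.base = D0.complex from hc] at h'
      exact D0.noConfusion h'⟩, A.snd, A.iso⟩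

/-- The inclusion `(id, 1, 1)` of an arc sub-object. [cite: MochizukiFrdII2008, Thm 3.6 (viii) p.38] -/
noncomputable def incl (A : C π) (hc : A.fst.IsComplexObj) (w' : normOneSubgroup ℂ) (η : ℝ)
    (hη : 0 < η) (hηπ : η < Real.pi) (hsub : arcDir w' η ⊆ A.fst.region.dir) :
    arcObj A hc w' η hη hηπ ⟶ A where
  fst :=
    { base := 𝟙 A.fst.base, degFr := 1, scalar := 1, scalar_mem := one_mem _,
      mapsTo := by
        change (1 : ℂˣ) • (arcRegion w' η hη hηπ A.fst.region.tip).carrier ^ ((1 : ℕ+) : ℕ) ⊆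
          C0.pullRegion A.fst (𝟙 A.fst.base)
        rw [one_smul, PNat.one_coe, pow_one, C0.pullRegion_id]
        intro u hu
        exact ⟨hsub hu.1, hu.2⟩ }
  snd := 𝟙 A.snd
  w := by
    change 𝟙 _ ≫ A.iso.hom = A.iso.hom ≫ π.map (𝟙 A.snd)
    rw [CategoryTheory.Functor.map_id, Category.id_comp, Category.comp_id]

/-- The positive real `1/2`. [cite: MochizukiFrdII2008, Thm 3.6 (viii) p.38] -/
noncomputable def half : PosReal := ⟨1 / 2, by norm_num⟩

/-- `1/2 ≤ 1`. [cite: MochizukiFrdII2008, Thm 3.6 (viii) p.38] -/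
theorem half_le_one : half ≤ 1 := by
  rw [← Subtype.coe_le_coe, Positive.val_one]; change (1 : ℝ) / 2 ≤ 1; norm_num

/-- The endomorphism `(id, 1, 1/2)` of an arc sub-object. [cite: MochizukiFrdII2008, Thm 3.6 (viii) p.38] -/
noncomputable def shrink (A : C π) (hc : A.fst.IsComplexObj) (w' : normOneSubgroup ℂ) (η : ℝ)
    (hη : 0 < η) (hηπ : η < Real.pi) : arcObj A hc w' η hη hηπ ⟶ arcObj A hc w' η hη hηπ where
  fst :=
    { base := 𝟙 A.fst.base, degFr := 1,
      scalar := ofPosReal ℂ half, scalar_mem := ofPosReal_mem_scalars _ _,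
      mapsTo := by
        change ofPosReal ℂ half • (arcRegion w' η hη hηπ A.fst.region.tip).carrier ^ ((1 : ℕ+) : ℕ) ⊆
          C0.pullRegion (arcObj A hc w' η hη hηπ).fst (𝟙 (arcObj A hc w' η hη hηπ).fst.base)
        rw [PNat.one_coe, pow_one, C0.pullRegion_id]
        rintro _ ⟨u, hu, rfl⟩
        refine ⟨?_, ?_⟩
        · change unitPart ℂ (ofPosReal ℂ half * u) ∈ _
          rw [unitPart_ofPosReal_mul]; exact hu.1
        · change absHom ℂ (ofPosReal ℂ half * u) ≤ _
          rw [absHom_ofPosReal_mul]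
          have hu2 := hu.2
          calc half * absHom ℂ u ≤ 1 * absHom ℂ u := by gcongr; exact half_le_one
            _ = absHom ℂ u := one_mul _
            _ ≤ _ := hu2 }
  snd := 𝟙 A.snd
  w := by
    change 𝟙 _ ≫ A.iso.hom = A.iso.hom ≫ π.map (𝟙 A.snd)
    rw [CategoryTheory.Functor.map_id, Category.id_comp, Category.comp_id]

/-- `shrink ≠ id` (scalars `1/2 ≠ 1`). [cite: MochizukiFrdII2008, Thm 3.6 (viii) p.38] -/
theorem shrink_ne_id (A : C π) (hc : A.fst.IsComplexObj) (w' : normOneSubgroup ℂ) (η : ℝ)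
    (hη : 0 < η) (hηπ : η < Real.pi) : shrink A hc w' η hη hηπ ≠ 𝟙 _ := by
  intro h
  have h' := congrArg (fun f => ((C0.scalar (CFP.Hom.fst f) : ℂˣ) : ℂ)) h
  change ((ofPosReal ℂ half : ℂˣ) : ℂ) = ((C0.scalar (𝟙 (arcObj A hc w' η hη hηπ).fst) : ℂˣ) : ℂ)
    at h'
  rw [C0.scalar_id', coe_ofPosReal, Units.val_one] at h'
  have h'' := congrArg Complex.re h'
  change ((1 : ℝ) / 2) = (1 : ℂ).re at h''
  norm_num at h''

/-- `ψ₀ ≫ incl₀ = ψ₁ ≫ incl₁` forces equal `(Base, deg_Fr, scalar)`. [cite: MochizukiFrdII2008, Thm 3.6 (viii) p.38] -/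
theorem data_eq_of_comp_eq {A B : C π} (hc : A.fst.IsComplexObj) {w₀ w₁ : normOneSubgroup ℂ} {η : ℝ}
    {hη : 0 < η} {hηπ : η < Real.pi} {hs₀ : arcDir w₀ η ⊆ A.fst.region.dir}
    {hs₁ : arcDir w₁ η ⊆ A.fst.region.dir} (ψ₀ : B ⟶ arcObj A hc w₀ η hη hηπ)
    (ψ₁ : B ⟶ arcObj A hc w₁ η hη hηπ)
    (h : ψ₀ ≫ incl A hc w₀ η hη hηπ hs₀ = ψ₁ ≫ incl A hc w₁ η hη hηπ hs₁) :
    C0.Base ψ₀.fst = C0.Base ψ₁.fst ∧ C0.degFr ψ₀.fst = C0.degFr ψ₁.fst ∧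
      C0.scalar ψ₀.fst = C0.scalar ψ₁.fst := by
  have hf := congrArg CFP.Hom.fst h
  rw [CFP.comp_fst, CFP.comp_fst] at hf
  refine ⟨?_, ?_, ?_⟩
  · have := congrArg C0.Hom.base hf
    change C0.Base ψ₀.fst ≫ 𝟙 _ = C0.Base ψ₁.fst ≫ 𝟙 _ at this
    rwa [Category.comp_id, Category.comp_id] at this
  · have := congrArg C0.Hom.degFr hf
    change C0.degFr ψ₀.fst * 1 = C0.degFr ψ₁.fst * 1 at this
    rwa [mul_one, mul_one] at this
  · have := congrArg C0.Hom.scalar hf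
    change (C0.Base ψ₀.fst).act 1 * C0.scalar ψ₀.fst ^ ((1 : ℕ+) : ℕ) =
      (C0.Base ψ₁.fst).act 1 * C0.scalar ψ₁.fst ^ ((1 : ℕ+) : ℕ) at this
    rwa [map_one, map_one, one_mul, one_mul, PNat.one_coe, pow_one, pow_one] at this

end WeakDissection

open WeakDissection in
/-- **Theorem 3.6 (viii) for `C = C^ℤ`** (PROVED, over any base `π : D → D₀`): the full subcategory
`C[ℂ]` of complex objects is of weakly dissectible type. [cite: MochizukiFrdII2008, Thm 3.6 (viii) p.38] -/
theorem thm36viii_C : Thm36viii (π ⋙ D0.toArchBase) (C.toElem π) MonoidType.Z := by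
  intro _
  refine ⟨fun Ah => ?_⟩
  obtain ⟨A, hA⟩ := Ah
  have hπ : (π.obj A.snd).IsComplex := (D0.isComplex_toArchBase_iff _).mp hA
  have hc : A.fst.IsComplexObj := isComplexObj_of_hom (A.iso.hom : A.fst.base ⟶ π.obj A.snd) hπ
  -- an arc inside the angular part of `A`
  obtain ⟨a, ha⟩ := C0.exists_mem_boundary A.fst.region
  obtain ⟨ε, hε, hεπ, hsub⟩ := exists_arcDir_subset A.fst.region.isOpen_dir (ha.1).1
  set w := unitPart ℂ a with hw
  have hε4 : 0 < ε / 4 := by linarith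
  have hε4π : ε / 4 < Real.pi := by linarith
  -- the two sub-arcs, indexed by `Fin 2`
  let δ : Fin 2 → ℝ := fun i => if i = 0 then ε / 2 else -(ε / 2)
  have hδ : ∀ i, |δ i| = ε / 2 := by
    intro i
    by_cases hi : i = 0
    · simp only [δ, if_pos hi]; exact abs_of_pos (by linarith)
    · simp only [δ, if_neg hi]; rw [abs_neg]; exact abs_of_pos (by linarith)
  have hs : ∀ i, arcDir (w * expUnit (δ i)) (ε / 4) ⊆ A.fst.region.dir :=
    fun i => (arcDir_shift_subset w hε hεπ (hδ i)).trans hsub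
  let P := RC.complexObjects (PreFrobenioid.baseFunctor (C.toElem π) ⋙ (π ⋙ D0.toArchBase))
  let X : Fin 2 → P.FullSubcategory :=
    fun i => ⟨arcObj A hc (w * expUnit (δ i)) (ε / 4) hε4 hε4π, hA⟩
  let φ : ∀ i, X i ⟶ (⟨A, hA⟩ : P.FullSubcategory) :=
    fun i => P.homMk (incl A hc (w * expUnit (δ i)) (ε / 4) hε4 hε4π (hs i))
  refine ⟨X, φ, fun i => ⟨fun hI => ?_⟩, ?_⟩
  · -- non-initial: two distinct endomorphisms
    have h := hI.hom_ext (P.homMk (shrink A hc (w * expUnit (δ i)) (ε / 4) hε4 hε4π) : X i ⟶ X i)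
      (𝟙 (X i))
    have h2 := congrArg InducedCategory.Hom.hom h
    exact shrink_ne_id A hc _ _ hε4 hε4π h2
  · intro i j hij B _ ψi ψj heq
    have heq' : ψi.hom ≫ incl A hc _ _ hε4 hε4π (hs i) = ψj.hom ≫ incl A hc _ _ hε4 hε4π (hs j) :=
      congrArg InducedCategory.Hom.hom heq
    obtain ⟨hb, hd, hsc⟩ := data_eq_of_comp_eq hc ψi.hom ψj.hom heq'
    -- a point of `B`'s region and its image under the common data `(b, d, c)`
    obtain ⟨b₀, hb₀⟩ := C0.exists_mem_boundary B.obj.fst.region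
    have hvi := (C0.Hom.mapsTo ψi.hom.fst) (Set.smul_mem_smul_set (a := C0.scalar ψi.hom.fst)
      (Set.pow_mem_pow hb₀.1 (n := (C0.degFr ψi.hom.fst : ℕ))))
    have hvj := (C0.Hom.mapsTo ψj.hom.fst) (Set.smul_mem_smul_set (a := C0.scalar ψj.hom.fst)
      (Set.pow_mem_pow hb₀.1 (n := (C0.degFr ψj.hom.fst : ℕ))))
    rw [← hd, ← hsc] at hvj
    obtain ⟨yi, hyi, hyieq⟩ := hvi
    obtain ⟨yj, hyj, hyjeq⟩ := hvj
    have hy : yi = yj := by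
      apply (D0.Hom.act (C0.Base ψi.hom.fst)).injective
      rw [hyieq, hb]
      exact hyjeq.symm
    -- `unitPart yi` lies in both arcs
    have h0 : unitPart ℂ yi ∈ arcDir (w * expUnit (δ i)) (ε / 4) := hyi.1
    have h1 : unitPart ℂ yi ∈ arcDir (w * expUnit (δ j)) (ε / 4) := hy ▸ hyj.1
    fin_cases i <;> fin_cases j
    · exact hij rfl
    · exact arcDir_disjoint w hε hεπ h0 h1
    · exact arcDir_disjoint w hε hεπ h1 h0
    · exact hij rfl

namespace WeakDissection

variable {π}

/-- The inclusion of an arc sub-object is an isometry (same tip, scalar `1`, degree `1`).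
[cite: MochizukiFrdII2008, Thm 3.6 (viii) p.38] -/
theorem isIsometry_incl (A : C π) (hc : A.fst.IsComplexObj) (w' : normOneSubgroup ℂ) (η : ℝ)
    (hη : 0 < η) (hηπ : η < Real.pi) (hsub : arcDir w' η ⊆ A.fst.region.dir) :
    PreFrobenioid.IsIsometry (C.toElem π) (incl A hc w' η hη hηπ hsub) := by
  have h0 : PreFrobenioid.IsIsometry C0.toElem (incl A hc w' η hη hηπ hsub).fst := by
    rw [A0.isIsometry_iff_norm_mul_tip_pow]
    change ‖((1 : ℂˣ) : ℂ)‖ * (A.fst.region.tip : ℝ) ^ ((1 : ℕ+) : ℕ) = A.fst.region.tip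
    rw [Units.val_one, norm_one, one_mul, PNat.one_coe, pow_one]
  change pull Φ₀ (arcObj A hc w' η hη hηπ).iso.inv
    (PreFrobenioid.Div C0.toElem (incl A hc w' η hη hηπ hsub).fst) = 1
  rw [h0]; exact map_one _

/-- The isotropic object of `C` with the same base data and tip as `A`.
[cite: MochizukiFrdII2008, Thm 3.6 (viii) p.38] -/
noncomputable def isoObj (A : C π) : C π :=
  ⟨⟨A.fst.base, AngularRegion.isotropicOfTip A.fst.region.tip,
    fun _ => AngularRegion.isIsotropic_isotropicOfTip _⟩, A.snd, A.iso⟩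

/-- The isometries `(id, 1, c)`, `|c| = 1`, from an arc sub-object to the isotropic object of the same
tip. [cite: MochizukiFrdII2008, Thm 3.6 (viii) p.38] -/
noncomputable def toIso (A : C π) (hc : A.fst.IsComplexObj) (w' : normOneSubgroup ℂ) (η : ℝ)
    (hη : 0 < η) (hηπ : η < Real.pi) (c : ℂˣ) (hn : ‖(c : ℂ)‖ = 1) :
    arcObj A hc w' η hη hηπ ⟶ isoObj A where
  fst :=
    { base := 𝟙 A.fst.base, degFr := 1, scalar := c,
      scalar_mem := by
        change c ∈ D0.scalars A.fst.base
        rw [show A.fst.base = D0.complex from hc, D0.scalars_complex]; trivial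
      mapsTo := by
        change c • (arcRegion w' η hη hηπ A.fst.region.tip).carrier ^ ((1 : ℕ+) : ℕ) ⊆
          C0.pullRegion (isoObj A).fst (𝟙 (isoObj A).fst.base)
        rw [PNat.one_coe, pow_one, C0.pullRegion_id]
        rintro _ ⟨u, hu, rfl⟩
        change c • u ∈ (AngularRegion.isotropicOfTip (K := ℂ) A.fst.region.tip).carrier
        rw [C0.mem_carrier_of_isIsotropic (AngularRegion.isIsotropic_isotropicOfTip _)]
        have hu2 : ‖(u : ℂ)‖ ≤ A.fst.region.tip := by
          have := hu.2
          rw [← Subtype.coe_le_coe, coe_absHom] at this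
          exact this
        rw [← Subtype.coe_le_coe, coe_absHom, smul_eq_mul, Units.val_mul, norm_mul, hn, one_mul]
        exact hu2 }
  snd := 𝟙 A.snd
  w := by
    change 𝟙 _ ≫ A.iso.hom = A.iso.hom ≫ π.map (𝟙 A.snd)
    rw [CategoryTheory.Functor.map_id, Category.id_comp, Category.comp_id]

/-- `toIso c` is an isometry. [cite: MochizukiFrdII2008, Thm 3.6 (viii) p.38] -/
theorem isIsometry_toIso (A : C π) (hc : A.fst.IsComplexObj) (w' : normOneSubgroup ℂ) (η : ℝ)
    (hη : 0 < η) (hηπ : η < Real.pi) (c : ℂˣ) (hn : ‖(c : ℂ)‖ = 1) :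
    PreFrobenioid.IsIsometry (C.toElem π) (toIso A hc w' η hη hηπ c hn) := by
  have h0 : PreFrobenioid.IsIsometry C0.toElem (toIso A hc w' η hη hηπ c hn).fst := by
    rw [A0.isIsometry_iff_norm_mul_tip_pow]
    change ‖(c : ℂ)‖ * (A.fst.region.tip : ℝ) ^ ((1 : ℕ+) : ℕ) = A.fst.region.tip
    rw [hn, one_mul, PNat.one_coe, pow_one]
  change pull Φ₀ (arcObj A hc w' η hη hηπ).iso.inv
    (PreFrobenioid.Div C0.toElem (toIso A hc w' η hη hηπ c hn).fst) = 1
  rw [h0]; exact map_one _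

/-- `toIso 1 ≠ toIso (−1)`. [cite: MochizukiFrdII2008, Thm 3.6 (viii) p.38] -/
theorem toIso_one_ne_neg (A : C π) (hc : A.fst.IsComplexObj) (w' : normOneSubgroup ℂ) (η : ℝ)
    (hη : 0 < η) (hηπ : η < Real.pi) (h1 : ‖((1 : ℂˣ) : ℂ)‖ = 1) (h2 : ‖((-1 : ℂˣ) : ℂ)‖ = 1) :
    toIso A hc w' η hη hηπ 1 h1 ≠ toIso A hc w' η hη hηπ (-1) h2 := by
  intro h
  have h' := congrArg (fun f => ((C0.scalar (CFP.Hom.fst f) : ℂˣ) : ℂ)) h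
  change ((1 : ℂˣ) : ℂ) = ((-1 : ℂˣ) : ℂ) at h'
  rw [Units.val_one, Units.val_neg, Units.val_one] at h'
  have h'' := congrArg Complex.re h'
  norm_num at h''

end WeakDissection

open WeakDissection in
/-- **Theorem 3.6 (viii) for the angular Frobenioid `A`** (PROVED, over any base): `A[ℂ]` is of weakly
dissectible type — the same arc sub-objects, whose inclusions are isometries; they are non-initial in
`A[ℂ]` because of the two isometries `(id, 1, ±1)` to the isotropic object of the same tip.
[cite: MochizukiFrdII2008, Thm 3.6 (viii) p.38] -/
theorem thm36viii_A : Thm36viii (π ⋙ D0.toArchBase) (A.toElem π) MonoidType.Z := by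
  intro _
  refine ⟨fun Xh => ?_⟩
  obtain ⟨X₀, hX⟩ := Xh
  let A : C π := X₀.obj
  have hπ : (π.obj A.snd).IsComplex := (D0.isComplex_toArchBase_iff _).mp hX
  have hc : A.fst.IsComplexObj := isComplexObj_of_hom (A.iso.hom : A.fst.base ⟶ π.obj A.snd) hπ
  obtain ⟨a, ha⟩ := C0.exists_mem_boundary A.fst.region
  obtain ⟨ε, hε, hεπ, hsub⟩ := exists_arcDir_subset A.fst.region.isOpen_dir (ha.1).1
  set w := unitPart ℂ a with hw
  have hε4 : 0 < ε / 4 := by linarith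
  have hε4π : ε / 4 < Real.pi := by linarith
  let δ : Fin 2 → ℝ := fun i => if i = 0 then ε / 2 else -(ε / 2)
  have hδ : ∀ i, |δ i| = ε / 2 := by
    intro i
    by_cases hi : i = 0
    · simp only [δ, if_pos hi]; exact abs_of_pos (by linarith)
    · simp only [δ, if_neg hi]; rw [abs_neg]; exact abs_of_pos (by linarith)
  have hs : ∀ i, arcDir (w * expUnit (δ i)) (ε / 4) ⊆ A.fst.region.dir :=
    fun i => (arcDir_shift_subset w hε hεπ (hδ i)).trans hsub
  let P := RC.complexObjects (PreFrobenioid.baseFunctor (ArchFrd.A.toElem π) ⋙ (π ⋙ D0.toArchBase))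
  let Xa : Fin 2 → ArchFrd.A π := fun i => ⟨arcObj A hc (w * expUnit (δ i)) (ε / 4) hε4 hε4π⟩
  let X : Fin 2 → P.FullSubcategory := fun i => ⟨Xa i, hX⟩
  let φ : ∀ i, X i ⟶ (⟨X₀, hX⟩ : P.FullSubcategory) :=
    fun i => P.homMk ⟨incl A hc (w * expUnit (δ i)) (ε / 4) hε4 hε4π (hs i),
      isIsometry_incl A hc _ _ hε4 hε4π (hs i)⟩
  have hn1 : ‖((1 : ℂˣ) : ℂ)‖ = 1 := by rw [Units.val_one, norm_one]
  have hn2 : ‖((-1 : ℂˣ) : ℂ)‖ = 1 := by rw [Units.val_neg, Units.val_one, norm_neg, norm_one]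
  refine ⟨X, φ, fun i => ⟨fun hI => ?_⟩, ?_⟩
  · -- non-initial: two distinct isometries to the isotropic object of the same tip
    let Y : P.FullSubcategory := ⟨⟨isoObj A⟩, hX⟩
    let g : ∀ (c : ℂˣ) (hn : ‖(c : ℂ)‖ = 1), X i ⟶ Y := fun c hn =>
      P.homMk ⟨toIso A hc (w * expUnit (δ i)) (ε / 4) hε4 hε4π c hn,
        isIsometry_toIso A hc _ _ hε4 hε4π c hn⟩
    have h := hI.hom_ext (g 1 hn1) (g (-1) hn2)
    have h2 := congrArg (fun f : X i ⟶ Y => f.hom.hom) h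
    exact toIso_one_ne_neg A hc _ _ hε4 hε4π hn1 hn2 h2
  · intro i j hij B _ ψi ψj heq
    have heq' : ψi.hom.hom ≫ incl A hc _ _ hε4 hε4π (hs i) =
        ψj.hom.hom ≫ incl A hc _ _ hε4 hε4π (hs j) :=
      congrArg (fun f : B ⟶ (⟨X₀, hX⟩ : P.FullSubcategory) => f.hom.hom) heq
    obtain ⟨hb, hd, hsc⟩ := data_eq_of_comp_eq hc ψi.hom.hom ψj.hom.hom heq'
    obtain ⟨b₀, hb₀⟩ := C0.exists_mem_boundary B.obj.obj.fst.region
    have hvi := (C0.Hom.mapsTo ψi.hom.hom.fst) (Set.smul_mem_smul_set (a := C0.scalar ψi.hom.hom.fst)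
      (Set.pow_mem_pow hb₀.1 (n := (C0.degFr ψi.hom.hom.fst : ℕ))))
    have hvj := (C0.Hom.mapsTo ψj.hom.hom.fst) (Set.smul_mem_smul_set (a := C0.scalar ψj.hom.hom.fst)
      (Set.pow_mem_pow hb₀.1 (n := (C0.degFr ψj.hom.hom.fst : ℕ))))
    rw [← hd, ← hsc] at hvj
    obtain ⟨yi, hyi, hyieq⟩ := hvi
    obtain ⟨yj, hyj, hyjeq⟩ := hvj
    have hy : yi = yj := by
      apply (D0.Hom.act (C0.Base ψi.hom.hom.fst)).injective
      rw [hyieq, hb]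
      exact hyjeq.symm
    have h0 : unitPart ℂ yi ∈ arcDir (w * expUnit (δ i)) (ε / 4) := hyi.1
    have h1 : unitPart ℂ yi ∈ arcDir (w * expUnit (δ j)) (ε / 4) := hy ▸ hyj.1
    fin_cases i <;> fin_cases j
    · exact hij rfl
    · exact arcDir_disjoint w hε hεπ h0 h1
    · exact arcDir_disjoint w hε hεπ h1 h0
    · exact hij rfl

end ArchFrd

end Literature.AlgebraicGeometry.Frobenioids
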